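import Summits.CriticalPhenomena.PercolationContinuityZ3.Theorems.PercNearOneGluingNoHeavyQuantSDEC
import HarnessLib

/-!
# QUANT lane: EVERY BALANCED ROW OF THE GATED CONVOLUTION IS FREE — the two-layer rows `d = k` with `2k < min(qT₁, qT₂)` of
# `gate (lconv μ₁ μ₂) q` hold for all independent top-affordable factors, at every floor and every gate, with no hypothesis on the factors

builds on p205010 (kernel theorem, internal audit signed; external expert review pending)

Support file (`--supports stmt-CriticalPhenomena-4575`), QUANT lane seat prim-quant-arm-3 (gen 165), memo
`run/shared/lean/prim/quant/prim-quant-arm-3-g165/ARM3-PHANTOM-K0.md` §6; companion of `…QuantTLBRowZero` (the row `k = 0`).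

THE THEOREM (`gateConv_row_balanced`).  Floor `0 < y < 1`, gate `y ≤ q ≤ 1`, `u = y/(1−y)`; probability laws `μ₁` on `{0..M₁}`, `μ₂` on `{0..M₂}`
with means `T₁`, `T₂`, top-affordable (`y·Mᵢ ≤ q·Tᵢ`); an integer `k` with `2k < q·T₁` and `2k < q·T₂` ("balanced": both factors own a row `k`).
Then the row `d = k` of `LawDec.TLB u (q(T₁+T₂)) (M₁+M₂) (gate (lconv M₁ M₂ μ₁ μ₂) q)` holds:
`u · Σ_{h ≤ k} ν h ≤ Σ_{h ≤ M₁+M₂, q(T₁+T₂) − k ≤ h} ν h`, `ν = gate (lconv M₁ M₂ μ₁ μ₂) q` — with NO two-layer / DEC hypothesis on the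
factors, no orientation, no `1/2 ≤ y`.  So the single-gate convolution closure of the two-layer family (`TLBGateConvClosed`, refuted for
`y < 1/2`; `TLBGateConvClosedHeavy`, conjectured) is entirely a statement about the UNBALANCED rows `min(qT₁,qT₂) ≤ 2k < q(T₁+T₂)/2`.

THE CERTIFICATE (two-level mean tilts, both factors alike; found by exact LP, see the memo).  `T := T₁+T₂`, `A := u/(T−k)`, `B := u/T`,
`r(n) := A` for `n ≤ k`, `B` for `n > k`.  For all cells `a ≤ M₁`, `s ≤ M₂` (only `y·a ≤ qT₁`, `y·s ≤ qT₂` is used):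
   `r(s)·(a − T₁) + r(a)·(s − T₂) ≤ q·[q T − k ≤ a+s] − u q·[a+s ≤ k] − u(1−q)`            (`balanced_cell`)
and the left side integrates to `0` against `μ₁ ⊗ μ₂` (independence + means), the right side to `RHS − u·LHS` of the row.
Cells, with `n = a+s`: both indices `≤ k`: `A(n−T) ≤ −u` iff `n ≤ k`, else `n ≤ 2k < qT + (1−q)k`; both `> k`: `B(n − T) ≤ −u(1−q)` iff
`n ≤ qT`, and on target cells `B(qT/y − T) = u(q−y)/y = q − u(1−q)` exactly; mixed (`a ≤ k < s`): middle cells clear denominators to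
`(a−T₁)(T−k) + (s−T₂)T + (1−q)T(T−k) ≤ −ak − k((1−q)T₁ + (2−q)T₂) ≤ 0` (at `s = qT−k−a`), target cells `B(a−T₁) ≤ 0` and
`A(s−T₂) ≤ u·T₂(q−y)/(y(T−k)) ≤ u(q−y)/y` because `T₂ ≤ T − k`.

* `LawDec.balanced_cell` — the pointwise inequality;  `LawDec.gateConv_row_balanced` — the row.
[this work]; the rows served belong to the gluing programme of [cite: KozmaNitzan2024, Conjecture 3 (p. 15)].
-/

noncomputable section

namespace Summit.CriticalPhenomena.PercolationContinuityZ3.Theorems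

namespace Quant

open Finset

namespace LawDec

/-! ### Bookkeeping (private copies of the test-function lemmas of `…QuantTwoLayerCertificate`, to keep the imports to `…QuantSDEC`) -/

/-- a test function against the convolution. [this work] -/
private theorem br_sum_fun_mul_lconv (M₁ M₂ : ℕ) (μ₁ μ₂ : ℕ → ℝ) (φ : ℕ → ℝ) :
    ∑ h ∈ Finset.range (M₁ + M₂ + 1), φ h * lconv M₁ M₂ μ₁ μ₂ h
      = ∑ a ∈ Finset.range (M₁ + 1), ∑ s ∈ Finset.range (M₂ + 1), φ (a + s) * (μ₁ a * μ₂ s) := by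
  simp only [lconv, Finset.mul_sum]
  rw [Finset.sum_comm]
  refine Finset.sum_congr rfl fun a ha => ?_
  rw [Finset.sum_comm]
  refine Finset.sum_congr rfl fun s hs => ?_
  rw [Finset.mem_range] at ha hs
  have e : ∀ h : ℕ, φ h * (if a + s = h then μ₁ a * μ₂ s else 0) = if a + s = h then φ (a + s) * (μ₁ a * μ₂ s) else 0 := by
    intro h
    split_ifs with hh
    · rw [hh]
    · rw [mul_zero]
  simp_rw [e]
  rw [Finset.sum_ite_eq (Finset.range (M₁ + M₂ + 1)) (a + s), if_pos (Finset.mem_range.2 (by omega))]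

/-- a test function against a gated law. [this work] -/
private theorem br_sum_fun_mul_gate (M : ℕ) (μ : ℕ → ℝ) (q : ℝ) (φ : ℕ → ℝ) :
    ∑ h ∈ Finset.range (M + 1), φ h * gate μ q h = q * ∑ h ∈ Finset.range (M + 1), φ h * μ h + (1 - q) * φ 0 := by
  simp only [gate]
  have e : ∀ h : ℕ, φ h * (q * μ h + (if h = 0 then 1 - q else 0)) = q * (φ h * μ h) + (if h = 0 then (1 - q) * φ 0 else 0) := by
    intro h
    split_ifs with hh
    · rw [hh]; ring
    · ring
  simp_rw [e]
  rw [Finset.sum_add_distrib, ← Finset.mul_sum, Finset.sum_ite_eq' (Finset.range (M + 1)) 0,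
    if_pos (Finset.mem_range.2 (Nat.succ_pos M))]

/-- the mean of a probability law on `{0..M}` is at most `M`. [this work] -/
private theorem br_mean_le (M : ℕ) (μ : ℕ → ℝ) (hμ : ∀ h, 0 ≤ μ h) (hμ1 : ∑ h ∈ Finset.range (M + 1), μ h = 1) :
    ∑ h ∈ Finset.range (M + 1), (h : ℝ) * μ h ≤ M := by
  calc ∑ h ∈ Finset.range (M + 1), (h : ℝ) * μ h ≤ ∑ h ∈ Finset.range (M + 1), (M : ℝ) * μ h := by
        refine Finset.sum_le_sum fun h hh => ?_
        rw [Finset.mem_range] at hh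
        exact mul_le_mul_of_nonneg_right (by exact_mod_cast Nat.lt_succ_iff.mp hh) (hμ h)
    _ = M := by rw [← Finset.mul_sum, hμ1, mul_one]

/-! ### The four regions of the certificate (pure real arithmetic) -/

/-- both indices `≤ k`, low cell (`n = a+s ≤ k`). [this work] -/
private theorem br_LL_low {u T k n : ℝ} (hu : 0 ≤ u) (hTk : k < T) (hn : n ≤ k) :
    u / (T - k) * (n - T) ≤ -u := by
  have hD : 0 < T - k := by linarith
  rw [div_mul_eq_mul_div, div_le_iff₀ hD]
  nlinarith

/-- both indices `≤ k`, middle cell (`k < n ≤ 2k`). [this work] -/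
private theorem br_LL_mid {u T k n q : ℝ} (hu : 0 ≤ u) (hk : 0 ≤ k) (hTk : k < T) (hq1 : q ≤ 1) (hn : n ≤ 2 * k) (h2k : 2 * k < q * T) :
    u / (T - k) * (n - T) ≤ -(u * (1 - q)) := by
  have hD : 0 < T - k := by linarith
  rw [div_mul_eq_mul_div, div_le_iff₀ hD]
  have h1 : n - T ≤ -((1 - q) * (T - k)) := by nlinarith
  nlinarith

/-- both indices `> k`, middle cell (`n < qT − k`). [this work] -/
private theorem br_HH_mid {u T k n q : ℝ} (hu : 0 ≤ u) (hk : 0 ≤ k) (hT : 0 < T) (hn : n ≤ q * T - k) :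
    u / T * (n - T) ≤ -(u * (1 - q)) := by
  rw [div_mul_eq_mul_div, div_le_iff₀ hT]
  have h1 : n - T ≤ -((1 - q) * T) := by linarith
  nlinarith

/-- both indices `> k`, target cell: the top-affordability identity `B·(qT/y − T) = u(q−y)/y`. [this work] -/
private theorem br_HH_tgt {y T n q : ℝ} (hy0 : 0 < y) (hy1 : y < 1) (hT : 0 < T) (hn : y * n ≤ q * T) :
    y / (1 - y) / T * (n - T) ≤ y / (1 - y) * (q - y) / y := by
  have h1y : 0 < 1 - y := by linarith
  have hu : 0 < y / (1 - y) := div_pos hy0 h1y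
  have key : (n - T) / T ≤ (q - y) / y := by
    rw [div_le_div_iff₀ hT hy0]
    nlinarith
  calc y / (1 - y) / T * (n - T) = y / (1 - y) * ((n - T) / T) := by ring
    _ ≤ y / (1 - y) * ((q - y) / y) := mul_le_mul_of_nonneg_left key hu.le
    _ = y / (1 - y) * (q - y) / y := by ring

/-- mixed region `a ≤ k < s`, middle cell (`a + s < qT − k`): after clearing denominators the slack is
`a k + k((1−q)T₁ + (2−q)T₂) ≥ 0`. [this work] -/
private theorem br_LH_mid {u T₁ T₂ k a s q : ℝ} (hu : 0 ≤ u) (hk : 0 ≤ k) (ha : 0 ≤ a) (hT1 : 0 ≤ T₁) (hT2 : 0 ≤ T₂)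
    (hq1 : q ≤ 1) (hTk : k < T₁ + T₂) (hcell : a + s ≤ q * (T₁ + T₂) - k) :
    u / (T₁ + T₂) * (a - T₁) + u / (T₁ + T₂ - k) * (s - T₂) ≤ -(u * (1 - q)) := by
  have hT : 0 < T₁ + T₂ := by linarith
  have hD : 0 < T₁ + T₂ - k := by linarith
  -- the cleared inequality
  have hid : (a - T₁) * (T₁ + T₂ - k) + (q * (T₁ + T₂) - k - a - T₂) * (T₁ + T₂) + (1 - q) * (T₁ + T₂) * (T₁ + T₂ - k)
      = -(a * k) - k * ((1 - q) * T₁ + (2 - q) * T₂) := by ring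
  have hsT : (s - T₂) * (T₁ + T₂) ≤ (q * (T₁ + T₂) - k - a - T₂) * (T₁ + T₂) :=
    mul_le_mul_of_nonneg_right (by linarith) hT.le
  have hak : 0 ≤ a * k := mul_nonneg ha hk
  have hkk : 0 ≤ k * ((1 - q) * T₁ + (2 - q) * T₂) := mul_nonneg hk (by nlinarith)
  have hcl : (a - T₁) * (T₁ + T₂ - k) + (s - T₂) * (T₁ + T₂) + (1 - q) * (T₁ + T₂) * (T₁ + T₂ - k) ≤ 0 := by linarith
  rw [div_mul_eq_mul_div, div_mul_eq_mul_div, div_add_div _ _ hT.ne' hD.ne', div_le_iff₀ (mul_pos hT hD)]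
  have h3 : 0 ≤ u * -((a - T₁) * (T₁ + T₂ - k) + (s - T₂) * (T₁ + T₂) + (1 - q) * (T₁ + T₂) * (T₁ + T₂ - k)) :=
    mul_nonneg hu (by linarith)
  nlinarith

/-- mixed region `a ≤ k < s`, target cell: `B(a − T₁) ≤ 0` and `A(s − T₂) ≤ u(q−y)/y` (because `T₂ ≤ T − k`). [this work] -/
private theorem br_LH_tgt {y T₁ T₂ k a s q : ℝ} (hy0 : 0 < y) (hy1 : y < 1) (hyq : y ≤ q) (hk : 0 ≤ k)
    (haT : a ≤ T₁) (hkT : k ≤ T₁) (hTk : k < T₁ + T₂) (hs : y * s ≤ q * T₂) :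
    y / (1 - y) / (T₁ + T₂) * (a - T₁) + y / (1 - y) / (T₁ + T₂ - k) * (s - T₂) ≤ y / (1 - y) * (q - y) / y := by
  have h1y : 0 < 1 - y := by linarith
  have hu : 0 < y / (1 - y) := div_pos hy0 h1y
  have hT : 0 < T₁ + T₂ := by linarith
  have hD : 0 < T₁ + T₂ - k := by linarith
  have h1 : y / (1 - y) / (T₁ + T₂) * (a - T₁) ≤ 0 := by
    have : y / (1 - y) / (T₁ + T₂) * (T₁ - a) ≥ 0 := mul_nonneg (div_pos hu hT).le (by linarith)
    linarith
  have h2 : (s - T₂) / (T₁ + T₂ - k) ≤ (q - y) / y := by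
    rw [div_le_div_iff₀ hD hy0]
    -- y (s - T₂) ≤ (q-y) T₂ ≤ (q - y)(T₁ + T₂ - k)
    have e1 : (s - T₂) * y ≤ (q - y) * T₂ := by nlinarith
    have e2 : (q - y) * T₂ ≤ (q - y) * (T₁ + T₂ - k) := mul_le_mul_of_nonneg_left (by linarith) (by linarith)
    linarith
  calc y / (1 - y) / (T₁ + T₂) * (a - T₁) + y / (1 - y) / (T₁ + T₂ - k) * (s - T₂)
      ≤ 0 + y / (1 - y) * ((s - T₂) / (T₁ + T₂ - k)) := by
        have : y / (1 - y) / (T₁ + T₂ - k) * (s - T₂) = y / (1 - y) * ((s - T₂) / (T₁ + T₂ - k)) := by ring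
        rw [this]; linarith
    _ ≤ 0 + y / (1 - y) * ((q - y) / y) := by
        have := mul_le_mul_of_nonneg_left h2 hu.le
        linarith
    _ = y / (1 - y) * (q - y) / y := by ring

/-! ### The pointwise certificate inequality -/

/-- **The two-level pure-tilt certificate of a balanced row, cell by cell.**  With `u = y/(1−y)`, `T = T₁+T₂`, `A = u/(T−k)`, `B = u/T`,
`r n = A` (`n ≤ k`) / `B` (`n > k`): for naturals `a, s` with `y·a ≤ qT₁`, `y·s ≤ qT₂`,
`r s·(a − T₁) + r a·(s − T₂) ≤ q·[qT − k ≤ a+s] − uq·[a+s ≤ k] − u(1−q)`. [this work] -/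
theorem balanced_cell {y q T₁ T₂ : ℝ} {k a s : ℕ} (hy0 : 0 < y) (hy1 : y < 1) (hyq : y ≤ q) (hq1 : q ≤ 1)
    (hk1 : 2 * (k : ℝ) < q * T₁) (hk2 : 2 * (k : ℝ) < q * T₂)
    (ha : y * (a : ℝ) ≤ q * T₁) (hs : y * (s : ℝ) ≤ q * T₂) :
    (if s ≤ k then y / (1 - y) / (T₁ + T₂ - k) else y / (1 - y) / (T₁ + T₂)) * ((a : ℝ) - T₁)
      + (if a ≤ k then y / (1 - y) / (T₁ + T₂ - k) else y / (1 - y) / (T₁ + T₂)) * ((s : ℝ) - T₂)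
    ≤ q * (if q * (T₁ + T₂) - k ≤ (a : ℝ) + s then 1 else 0) - y / (1 - y) * q * (if a + s ≤ k then 1 else 0)
        - y / (1 - y) * (1 - q) := by
  have h1y : 0 < 1 - y := by linarith
  have hu : 0 < y / (1 - y) := div_pos hy0 h1y
  have hq0 : 0 < q := lt_of_lt_of_le hy0 hyq
  have hk : (0 : ℝ) ≤ k := Nat.cast_nonneg k
  have hT1 : 0 < T₁ := by nlinarith
  have hT2 : 0 < T₂ := by nlinarith
  have hkT1 : (k : ℝ) ≤ T₁ := by nlinarith
  have hkT2 : (k : ℝ) ≤ T₂ := by nlinarith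
  have hTk : (k : ℝ) < T₁ + T₂ := by linarith
  have hT : 0 < T₁ + T₂ := by linarith
  have ha0 : (0 : ℝ) ≤ a := Nat.cast_nonneg a
  have hs0 : (0 : ℝ) ≤ s := Nat.cast_nonneg s
  -- the target value `q − u(1−q)` equals `u(q−y)/y`
  have hid : q * 1 - y / (1 - y) * q * 0 - y / (1 - y) * (1 - q) = y / (1 - y) * (q - y) / y := by
    field_simp
    ring
  by_cases hsk : s ≤ k <;> by_cases hak : a ≤ k <;> simp only [hsk, hak, if_true, if_false]
  · -- region LL: a ≤ k, s ≤ k; no target cells (a + s ≤ 2k < qT − k)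
    have hsk' : (s : ℝ) ≤ k := by exact_mod_cast hsk
    have hak' : (a : ℝ) ≤ k := by exact_mod_cast hak
    have hnt : ¬ (q * (T₁ + T₂) - k ≤ (a : ℝ) + s) := by
      intro h; nlinarith
    rw [if_neg hnt]
    by_cases hlow : a + s ≤ k
    · rw [if_pos hlow]
      have hlow' : (a : ℝ) + s ≤ k := by exact_mod_cast hlow
      have := br_LL_low (T := T₁ + T₂) hu.le hTk hlow'
      have e : y / (1 - y) / (T₁ + T₂ - ↑k) * (↑a - T₁) + y / (1 - y) / (T₁ + T₂ - ↑k) * (↑s - T₂)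
          = y / (1 - y) / (T₁ + T₂ - ↑k) * ((↑a + ↑s) - (T₁ + T₂)) := by ring
      rw [e]
      nlinarith
    · rw [if_neg hlow]
      have hn : (a : ℝ) + s ≤ 2 * k := by linarith
      have h2k : 2 * (k : ℝ) < q * (T₁ + T₂) := by nlinarith
      have := br_LL_mid (T := T₁ + T₂) (n := (a : ℝ) + s) hu.le hk hTk hq1 hn h2k
      have e : y / (1 - y) / (T₁ + T₂ - ↑k) * (↑a - T₁) + y / (1 - y) / (T₁ + T₂ - ↑k) * (↑s - T₂)
          = y / (1 - y) / (T₁ + T₂ - ↑k) * ((↑a + ↑s) - (T₁ + T₂)) := by ring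
      rw [e]
      linarith
  · -- region HL: s ≤ k < a
    have hak' : (k : ℝ) + 1 ≤ a := by exact_mod_cast Nat.lt_of_not_le hak
    have hnl : ¬ (a + s ≤ k) := by omega
    rw [if_neg hnl]
    by_cases htg : q * (T₁ + T₂) - k ≤ (a : ℝ) + s
    · rw [if_pos htg, hid]
      have hsT : (s : ℝ) ≤ T₂ := le_trans (by exact_mod_cast hsk) hkT2
      have := br_LH_tgt (T₁ := T₂) (T₂ := T₁) (a := (s : ℝ)) (s := (a : ℝ)) hy0 hy1 hyq hk hsT hkT2 (by linarith) ha
      have e1 : T₂ + T₁ = T₁ + T₂ := add_comm _ _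
      rw [e1] at this
      linarith
    · rw [if_neg htg]
      have hcell : (s : ℝ) + a ≤ q * (T₂ + T₁) - k := by linarith
      have := br_LH_mid (T₁ := T₂) (T₂ := T₁) (a := (s : ℝ)) (s := (a : ℝ)) hu.le hk hs0 hT2.le hT1.le hq1 (by linarith) hcell
      have e1 : T₂ + T₁ = T₁ + T₂ := add_comm _ _
      rw [e1] at this
      linarith
  · -- region LH: a ≤ k < s
    have hsk' : (k : ℝ) + 1 ≤ s := by exact_mod_cast Nat.lt_of_not_le hsk
    have hnl : ¬ (a + s ≤ k) := by omega
    rw [if_neg hnl]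
    by_cases htg : q * (T₁ + T₂) - k ≤ (a : ℝ) + s
    · rw [if_pos htg, hid]
      have haT : (a : ℝ) ≤ T₁ := le_trans (by exact_mod_cast hak) hkT1
      have := br_LH_tgt hy0 hy1 hyq hk haT hkT1 hTk hs
      linarith
    · rw [if_neg htg]
      have hcell : (a : ℝ) + s ≤ q * (T₁ + T₂) - k := by linarith
      have := br_LH_mid hu.le hk ha0 hT1.le hT2.le hq1 hTk hcell
      linarith
  · -- region HH: a > k, s > k
    have hak' : (k : ℝ) + 1 ≤ a := by exact_mod_cast Nat.lt_of_not_le hak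
    have hsk' : (k : ℝ) + 1 ≤ s := by exact_mod_cast Nat.lt_of_not_le hsk
    have hnl : ¬ (a + s ≤ k) := by omega
    rw [if_neg hnl]
    have e : y / (1 - y) / (T₁ + T₂) * (↑a - T₁) + y / (1 - y) / (T₁ + T₂) * (↑s - T₂)
        = y / (1 - y) / (T₁ + T₂) * ((↑a + ↑s) - (T₁ + T₂)) := by ring
    rw [e]
    by_cases htg : q * (T₁ + T₂) - k ≤ (a : ℝ) + s
    · rw [if_pos htg, hid]
      have hn : y * ((a : ℝ) + s) ≤ q * (T₁ + T₂) := by nlinarith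
      exact br_HH_tgt hy0 hy1 hT hn
    · rw [if_neg htg]
      have hn : (a : ℝ) + s ≤ q * (T₁ + T₂) - k := by linarith
      have := br_HH_mid (n := (a : ℝ) + s) hu.le hk hT hn
      linarith

/-! ### The row -/

/-- **EVERY BALANCED ROW OF THE GATED CONVOLUTION IS FREE.**  For a floor `0 < y < 1`, a gate `y ≤ q ≤ 1`, probability laws `μ₁` on `{0..M₁}`
and `μ₂` on `{0..M₂}` (nonnegative, mass `1`, means `T₁`, `T₂`) that are top-affordable (`y·Mᵢ ≤ q·Tᵢ`), and an integer `k` with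
`2k < q·T₁` and `2k < q·T₂`: the two-layer row `d = k` of the gated convolution at threshold `q(T₁+T₂)`,
`y/(1−y) · Σ_{h ≤ k} ν h ≤ Σ_{h ≤ M₁+M₂, q(T₁+T₂) − k ≤ h} ν h`, `ν = gate (lconv M₁ M₂ μ₁ μ₂) q` — with no hypothesis on the shape of
the factors (in particular none of the two-layer rows of `gate μᵢ q` that `TLBGateConvClosed` assumes). [this work] -/
theorem gateConv_row_balanced {y q T₁ T₂ : ℝ} {M₁ M₂ k : ℕ} {μ₁ μ₂ : ℕ → ℝ}
    (hy0 : 0 < y) (hy1 : y < 1) (hyq : y ≤ q) (hq1 : q ≤ 1)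
    (h10 : ∀ h, 0 ≤ μ₁ h) (h11 : ∑ h ∈ Finset.range (M₁ + 1), μ₁ h = 1) (hT1 : ∑ h ∈ Finset.range (M₁ + 1), (h : ℝ) * μ₁ h = T₁)
    (h20 : ∀ h, 0 ≤ μ₂ h) (h21 : ∑ h ∈ Finset.range (M₂ + 1), μ₂ h = 1) (hT2 : ∑ h ∈ Finset.range (M₂ + 1), (h : ℝ) * μ₂ h = T₂)
    (hTA1 : y * (M₁ : ℝ) ≤ q * T₁) (hTA2 : y * (M₂ : ℝ) ≤ q * T₂)
    (hk1 : 2 * (k : ℝ) < q * T₁) (hk2 : 2 * (k : ℝ) < q * T₂) :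
    y / (1 - y) * ∑ h ∈ Finset.range (k + 1), gate (lconv M₁ M₂ μ₁ μ₂) q h
      ≤ ∑ h ∈ Finset.range (M₁ + M₂ + 1),
          (if q * (T₁ + T₂) - k ≤ (h : ℝ) then gate (lconv M₁ M₂ μ₁ μ₂) q h else 0) := by
  have h1y : 0 < 1 - y := by linarith
  have hu : 0 < y / (1 - y) := div_pos hy0 h1y
  have hq0 : 0 < q := lt_of_lt_of_le hy0 hyq
  have hkr : (0 : ℝ) ≤ k := Nat.cast_nonneg k
  -- k ≤ M₁ (so that the low sum is a test function on `{0..M₁+M₂}`)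
  have hT1M : T₁ ≤ M₁ := by rw [← hT1]; exact br_mean_le M₁ μ₁ h10 h11
  have hkM : k ≤ M₁ + M₂ := by
    have : (k : ℝ) ≤ M₁ := by nlinarith
    have : k ≤ M₁ := by exact_mod_cast this
    omega
  set ν := gate (lconv M₁ M₂ μ₁ μ₂) q with hν
  -- the low sum as a test function
  have hlow : ∑ h ∈ Finset.range (k + 1), ν h
      = ∑ h ∈ Finset.range (M₁ + M₂ + 1), (if h ≤ k then (1 : ℝ) else 0) * ν h := by
    rw [← Finset.sum_filter_add_sum_filter_not (Finset.range (M₁ + M₂ + 1)) (fun h => h ≤ k)]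
    have hz : ∑ h ∈ Finset.filter (fun h => ¬ h ≤ k) (Finset.range (M₁ + M₂ + 1)), (if h ≤ k then (1 : ℝ) else 0) * ν h = 0 := by
      refine Finset.sum_eq_zero fun h hh => ?_
      rw [Finset.mem_filter] at hh
      rw [if_neg hh.2, zero_mul]
    have hf : Finset.filter (fun h => h ≤ k) (Finset.range (M₁ + M₂ + 1)) = Finset.range (k + 1) := by
      ext h
      simp only [Finset.mem_filter, Finset.mem_range]
      omega
    rw [hz, add_zero, hf]
    refine Finset.sum_congr rfl fun h hh => ?_
    rw [Finset.mem_range] at hh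
    rw [if_pos (by omega), one_mul]
  -- the high sum as a test function
  have hhigh : ∑ h ∈ Finset.range (M₁ + M₂ + 1), (if q * (T₁ + T₂) - k ≤ (h : ℝ) then ν h else 0)
      = ∑ h ∈ Finset.range (M₁ + M₂ + 1), (if q * (T₁ + T₂) - k ≤ (h : ℝ) then (1 : ℝ) else 0) * ν h :=
    Finset.sum_congr rfl fun h _ => by split_ifs <;> simp
  rw [hlow, hhigh, hν, br_sum_fun_mul_gate, br_sum_fun_mul_gate, br_sum_fun_mul_lconv, br_sum_fun_mul_lconv]
  simp only [Nat.zero_le, if_true, Nat.cast_zero, mul_one]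
  have hnt0 : ¬ (q * (T₁ + T₂) - k ≤ (0 : ℝ)) := by
    intro h; nlinarith
  rw [if_neg hnt0, mul_zero, add_zero]
  -- the product mass and the tilt sums
  have hmass : ∑ a ∈ Finset.range (M₁ + 1), ∑ s ∈ Finset.range (M₂ + 1), μ₁ a * μ₂ s = 1 := by
    rw [← Finset.sum_mul_sum, h11, h21, one_mul]
  have htilt1 : ∑ a ∈ Finset.range (M₁ + 1), ∑ s ∈ Finset.range (M₂ + 1),
      (if s ≤ k then y / (1 - y) / (T₁ + T₂ - k) else y / (1 - y) / (T₁ + T₂)) * ((a : ℝ) - T₁) * (μ₁ a * μ₂ s) = 0 := by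
    rw [Finset.sum_comm]
    refine Finset.sum_eq_zero fun s _ => ?_
    have e : ∀ a ∈ Finset.range (M₁ + 1),
        (if s ≤ k then y / (1 - y) / (T₁ + T₂ - k) else y / (1 - y) / (T₁ + T₂)) * ((a : ℝ) - T₁) * (μ₁ a * μ₂ s)
          = ((if s ≤ k then y / (1 - y) / (T₁ + T₂ - k) else y / (1 - y) / (T₁ + T₂)) * μ₂ s) * ((a : ℝ) * μ₁ a - T₁ * μ₁ a) := by
      intro a _; ring
    rw [Finset.sum_congr rfl e, ← Finset.mul_sum, Finset.sum_sub_distrib, ← Finset.mul_sum, hT1, h11, mul_one, sub_self, mul_zero]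
  have htilt2 : ∑ a ∈ Finset.range (M₁ + 1), ∑ s ∈ Finset.range (M₂ + 1),
      (if a ≤ k then y / (1 - y) / (T₁ + T₂ - k) else y / (1 - y) / (T₁ + T₂)) * ((s : ℝ) - T₂) * (μ₁ a * μ₂ s) = 0 := by
    refine Finset.sum_eq_zero fun a _ => ?_
    have e : ∀ s ∈ Finset.range (M₂ + 1),
        (if a ≤ k then y / (1 - y) / (T₁ + T₂ - k) else y / (1 - y) / (T₁ + T₂)) * ((s : ℝ) - T₂) * (μ₁ a * μ₂ s)
          = ((if a ≤ k then y / (1 - y) / (T₁ + T₂ - k) else y / (1 - y) / (T₁ + T₂)) * μ₁ a) * ((s : ℝ) * μ₂ s - T₂ * μ₂ s) := by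
      intro s _; ring
    rw [Finset.sum_congr rfl e, ← Finset.mul_sum, Finset.sum_sub_distrib, ← Finset.mul_sum, hT2, h21, mul_one, sub_self, mul_zero]
  -- the pointwise inequality, weighted and summed
  have hsum : ∑ a ∈ Finset.range (M₁ + 1), ∑ s ∈ Finset.range (M₂ + 1),
      ((if s ≤ k then y / (1 - y) / (T₁ + T₂ - k) else y / (1 - y) / (T₁ + T₂)) * ((a : ℝ) - T₁) * (μ₁ a * μ₂ s)
        + (if a ≤ k then y / (1 - y) / (T₁ + T₂ - k) else y / (1 - y) / (T₁ + T₂)) * ((s : ℝ) - T₂) * (μ₁ a * μ₂ s))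
      ≤ ∑ a ∈ Finset.range (M₁ + 1), ∑ s ∈ Finset.range (M₂ + 1),
        (q * (if q * (T₁ + T₂) - k ≤ (a : ℝ) + s then (1 : ℝ) else 0) - y / (1 - y) * q * (if a + s ≤ k then (1 : ℝ) else 0)
          - y / (1 - y) * (1 - q)) * (μ₁ a * μ₂ s) := by
    refine Finset.sum_le_sum fun a ha => Finset.sum_le_sum fun s hs => ?_
    rw [Finset.mem_range] at ha hs
    have haM : (a : ℝ) ≤ M₁ := by exact_mod_cast Nat.lt_succ_iff.mp ha
    have hsM : (s : ℝ) ≤ M₂ := by exact_mod_cast Nat.lt_succ_iff.mp hs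
    have hcell := balanced_cell (T₁ := T₁) (T₂ := T₂) (k := k) (a := a) (s := s) hy0 hy1 hyq hq1 hk1 hk2
      (by nlinarith) (by nlinarith)
    have hw : 0 ≤ μ₁ a * μ₂ s := mul_nonneg (h10 a) (h20 s)
    nlinarith
  have hL : ∑ a ∈ Finset.range (M₁ + 1), ∑ s ∈ Finset.range (M₂ + 1),
      ((if s ≤ k then y / (1 - y) / (T₁ + T₂ - k) else y / (1 - y) / (T₁ + T₂)) * ((a : ℝ) - T₁) * (μ₁ a * μ₂ s)
        + (if a ≤ k then y / (1 - y) / (T₁ + T₂ - k) else y / (1 - y) / (T₁ + T₂)) * ((s : ℝ) - T₂) * (μ₁ a * μ₂ s)) = 0 := by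
    rw [Finset.sum_congr rfl fun a _ => Finset.sum_add_distrib, Finset.sum_add_distrib, htilt1, htilt2, add_zero]
  -- unpack the right-hand side of hsum
  have hR : ∑ a ∈ Finset.range (M₁ + 1), ∑ s ∈ Finset.range (M₂ + 1),
      (q * (if q * (T₁ + T₂) - k ≤ (a : ℝ) + s then (1 : ℝ) else 0) - y / (1 - y) * q * (if a + s ≤ k then (1 : ℝ) else 0)
          - y / (1 - y) * (1 - q)) * (μ₁ a * μ₂ s)
      = q * ∑ a ∈ Finset.range (M₁ + 1), ∑ s ∈ Finset.range (M₂ + 1),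
            (if q * (T₁ + T₂) - k ≤ ((a + s : ℕ) : ℝ) then (1 : ℝ) else 0) * (μ₁ a * μ₂ s)
        - y / (1 - y) * q * ∑ a ∈ Finset.range (M₁ + 1), ∑ s ∈ Finset.range (M₂ + 1),
            (if a + s ≤ k then (1 : ℝ) else 0) * (μ₁ a * μ₂ s)
        - y / (1 - y) * (1 - q) * ∑ a ∈ Finset.range (M₁ + 1), ∑ s ∈ Finset.range (M₂ + 1), μ₁ a * μ₂ s := by
    rw [Finset.mul_sum, Finset.mul_sum, Finset.mul_sum, ← Finset.sum_sub_distrib, ← Finset.sum_sub_distrib]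
    refine Finset.sum_congr rfl fun a _ => ?_
    rw [Finset.mul_sum, Finset.mul_sum, Finset.mul_sum, ← Finset.sum_sub_distrib, ← Finset.sum_sub_distrib]
    refine Finset.sum_congr rfl fun s _ => ?_
    push_cast
    ring
  rw [hL, hR, hmass, mul_one] at hsum
  linarith

end LawDec

end Quant

end Summit.CriticalPhenomena.PercolationContinuityZ3.Theorems
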